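import Literature.Probability.Percolation.FiveArmShift
import HarnessLib

/-!
# The central five-arm site, I: straight extensions, slab crossings and two corner crossing lemmas

Topic `Literature/Probability/Percolation`; family `crit-perc`. PROOFS ONLY (no definition of a
named fact). Planar-topological groundwork, entirely from the crossing lemma
`PathIn.tri_crossings_meet` (Kesten 1982, §2.2: a left–right and a top–bottom crossing of a
parallelogram of `𝕋` share a site), for the separation-free proof of the near-critical a priori
LOWER bound of the ALTERNATING four-arm probability
`π̂^alt_t(m, n) ≥ c (m/n)^{2-β}` (W. Werner, *Lectures on two-dimensional critical percolation*,
PCMI 2009, Lecture 6, §3, third a priori estimate; P. Nolin, *Near-critical percolation in two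
dimensions*, EJP 13 (2008), Thm. 24 (ii) and Thm. 27 [arXiv 0711.4948: Thm. 23 (ii), Thm. 26]),
the hypothesis `hLB` of `Nolin2008_thm27_oneArm_of_altHyps` (`NearCriticalOneArmFromAltFacts.lean`)
and of `Werner2009_oneArm_logDeriv_of_altSeparation` (`OneArmLogDerivFromAltSeparation.lean`).
The bound comes from a five-arm site `v` of the lowest crossing (the construction of
`FiveArmFrontier/Site/Arms.lean`, after Nolin, proof of Thm. 24 (ii), arXiv p. 17) placed in the
CENTRE of a large arena, four of whose arms reach the four sides of the arena; this file supplies: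

* `pathIn_line` — straight segments `x, x + e, …, x + k e` are paths;
* `band_meet`, `column_meet` — a path traversing a horizontal band (a vertical column) of a
  parallelogram meets every left–right (top–bottom) crossing of it;
* `corner_meet_left`, `corner_meet_right` — **corner crossing lemmas**: in `[L, R] × [B, T]`, a
  path from a point of the left (right) side to the top side meets every path from a HIGHER point
  of the same side to the bottom side (the two paths are completed, outside the parallelogram, to
  a top–bottom and a left–right crossing of `[L-1, R] × [B-1, T]`, resp. `[L, R+1] × [B-1, T]`).

## References

* H. Kesten, *Percolation theory for mathematicians*, Birkhäuser (1982), §2.2–2.3 (paths crossing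
  a rectangle meet) [KestenPTM1982].
* P. Nolin, Near-critical percolation in two dimensions, *Electron. J. Probab.* 13 (2008)
  1562–1623, §5.2, proof of Thm. 24 (ii) (arXiv 0711.4948: Thm. 23 (ii), p. 17) [Nolin2008].
* W. Werner, *Lectures on two-dimensional critical percolation*, IAS/Park City Math. Ser. 16
  (2009), Lecture 6, §3; first exercise sheet, "Five-arm exponent" [WernerPCMI2009].

## Mathlib / tree

Tree: `PathIn` and its API (`SitePaths.lean`), `PathIn.tri_crossings_meet(')`
(`TriCrossingsMeet.lean`), `PathIn.exists_slab_crossing` (`TriPathCrossings.lean`), `triE0`, `triE1`, `triGraph_adj_add_triE0/1`, `triGraph_adj_coord`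
(`TriHexLemma.lean`). Mathlib: `Relation.ReflTransGen` (through `PathIn`), `omega`.
-/

noncomputable section

open Set

namespace Literature.Probability.Percolation

open LatticeModels

/-! ### Straight segments -/

/-- **A straight segment is a path**: if `z ∼ z + e` for every site `z`, and the sites
`x, x + e, …, x + k e` lie in `S`, then `S` contains a path from `x` to `x + k e`. [folklore] -/
theorem pathIn_line {S : Set (Site 2)} {e : Site 2} (hadj : ∀ z : Site 2, triGraph.Adj z (z + e))
    (x : Site 2) (k : ℕ) (hS : ∀ j : ℕ, j ≤ k → x + (j : ℤ) • e ∈ S) :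
    PathIn triGraph S x (x + (k : ℤ) • e) := by
  induction k with
  | zero => simpa using PathIn.refl (by simpa using hS 0 le_rfl)
  | succ k ih =>
    have h := ih fun j hj => hS j (Nat.le_succ_of_le hj)
    have hadj' : triGraph.Adj (x + (k : ℤ) • e) (x + ((k + 1 : ℕ) : ℤ) • e) := by
      have := hadj (x + (k : ℤ) • e)
      convert this using 1
      push_cast
      rw [add_smul, one_smul, add_assoc]
    exact h.tail hadj' (hS (k + 1) le_rfl)

/-- `z ∼ z - e₀` in `𝕋`. [folklore] -/
theorem triGraph_adj_sub_triE0 (z : Site 2) : triGraph.Adj z (z - triE0) := by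
  have := triGraph_adj_add_triE0 (z - triE0)
  rw [sub_add_cancel] at this
  exact this.symm

/-- `z ∼ z - e₁` in `𝕋`. [folklore] -/
theorem triGraph_adj_sub_triE1 (z : Site 2) : triGraph.Adj z (z - triE1) := by
  have := triGraph_adj_add_triE1 (z - triE1)
  rw [sub_add_cancel] at this
  exact this.symm

/-- `z ∼ z + (-e₀)`. [folklore] -/
theorem triGraph_adj_add_neg_triE0 (z : Site 2) : triGraph.Adj z (z + -triE0) := by
  rw [← sub_eq_add_neg]; exact triGraph_adj_sub_triE0 z

/-- `z ∼ z + (-e₁)`. [folklore] -/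
theorem triGraph_adj_add_neg_triE1 (z : Site 2) : triGraph.Adj z (z + -triE1) := by
  rw [← sub_eq_add_neg]; exact triGraph_adj_sub_triE1 z

/-- Coordinates along a ray in direction `-e₀`. [folklore] -/
@[simp] theorem ray_neg_triE0_apply (x : Site 2) (j : ℤ) :
    (x + j • -triE0) 0 = x 0 - j ∧ (x + j • -triE0) 1 = x 1 := by
  constructor <;> simp [triE0, sub_eq_add_neg]

/-- Coordinates along a ray in direction `-e₁`. [folklore] -/
@[simp] theorem ray_neg_triE1_apply (x : Site 2) (j : ℤ) :
    (x + j • -triE1) 0 = x 0 ∧ (x + j • -triE1) 1 = x 1 - j := by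
  constructor <;> simp [triE1, sub_eq_add_neg]

/-! ### A path traversing a band meets its crossings -/

/-- **A path traversing a horizontal band meets every left–right crossing of the band.** In the
columns `[L, R]`: if `ξ` is a path of `A_ξ ⊆ [L, R] × [b₀, b₁]` from the left side to the right
side and `P` a path of `A ⊆ [L, R] × ℤ` from a site of row `≤ b₀` to a site of row `≥ b₁`, then
`A ∩ A_ξ ≠ ∅`. [cite: KestenPTM1982, §2.2 (paths crossing a rectangle must intersect)] -/
theorem band_meet {L R b₀ b₁ : ℤ} (hb : b₀ ≤ b₁) {Aξ A : Set (Site 2)} {x y p q : Site 2}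
    (hAξ : ∀ z ∈ Aξ, L ≤ z 0 ∧ z 0 ≤ R ∧ b₀ ≤ z 1 ∧ z 1 ≤ b₁) (hξ : PathIn triGraph Aξ x y)
    (hx : x 0 = L) (hy : y 0 = R) (hA : ∀ z ∈ A, L ≤ z 0 ∧ z 0 ≤ R) (hP : PathIn triGraph A p q)
    (hp : p 1 ≤ b₀) (hq : b₁ ≤ q 1) : ∃ z, z ∈ A ∧ z ∈ Aξ := by
  obtain ⟨p', q', hp', hq', hP'⟩ := hP.exists_slab_crossing 1 hb hp hq
  obtain ⟨z, hz, hz'⟩ := PathIn.tri_crossings_meet (L := L) (R := R) (B := b₀) (T := b₁) hAξ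
    (fun z hz => ⟨(hA z hz.1).1, (hA z hz.1).2, hz.2.1, hz.2.2⟩) hξ hx hy hP' hp' hq'
  exact ⟨z, hz'.1, hz⟩

/-- **A path traversing a vertical column meets every top–bottom crossing of the column.** In the
rows `[B, T]`: if `ζ` is a path of `A_ζ ⊆ [a₀, a₁] × [B, T]` from the bottom to the top row and `P`
a path of `A ⊆ ℤ × [B, T]` from a site of column `≤ a₀` to a site of column `≥ a₁`, then
`A ∩ A_ζ ≠ ∅`. [cite: KestenPTM1982, §2.2 (paths crossing a rectangle must intersect)] -/
theorem column_meet {B T a₀ a₁ : ℤ} (ha : a₀ ≤ a₁) {Aζ A : Set (Site 2)} {x y p q : Site 2}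
    (hAζ : ∀ z ∈ Aζ, a₀ ≤ z 0 ∧ z 0 ≤ a₁ ∧ B ≤ z 1 ∧ z 1 ≤ T) (hζ : PathIn triGraph Aζ x y)
    (hx : x 1 = B) (hy : y 1 = T) (hA : ∀ z ∈ A, B ≤ z 1 ∧ z 1 ≤ T) (hP : PathIn triGraph A p q)
    (hp : p 0 ≤ a₀) (hq : a₁ ≤ q 0) : ∃ z, z ∈ A ∧ z ∈ Aζ := by
  obtain ⟨p', q', hp', hq', hP'⟩ := hP.exists_slab_crossing 0 ha hp hq
  obtain ⟨z, hz, hz'⟩ := PathIn.tri_crossings_meet (L := a₀) (R := a₁) (B := B) (T := T)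
    (fun z hz => ⟨hz.2.1, hz.2.2, (hA z hz.1).1, (hA z hz.1).2⟩) hAζ hP' hp' hq' hζ hx hy
  exact ⟨z, hz.1, hz'⟩

/-! ### The corner crossing lemmas -/

/-- **Corner crossing lemma, left side.** In the parallelogram `[L, R] × [B, T]` of `𝕋`: a path
from a site `a` of the left side to the top side meets every path from a HIGHER site `c` of the
left side (`a₁ < c₁`) to the bottom side. Proof: extend the first path by the column
`{L-1} × [B-1, a₁]` (down to the corner `(L-1, B-1)`), the second by the site `(L-1, c₁)` and the
row `{B-1} × [d₀, R]` (from its foot `d`); these are a top–bottom and a left–right crossing of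
`[L-1, R] × [B-1, T]`, so they meet (`PathIn.tri_crossings_meet`), and the added sites are
pairwise distinct and off the other path. [cite: KestenPTM1982, §2.2 (paths crossing a rectangle must intersect)] -/
theorem corner_meet_left {L R B T : ℤ} {A A' : Set (Site 2)} {a t c d : Site 2}
    (hA : ∀ z ∈ A, L ≤ z 0 ∧ z 0 ≤ R ∧ B ≤ z 1 ∧ z 1 ≤ T)
    (hA' : ∀ z ∈ A', L ≤ z 0 ∧ z 0 ≤ R ∧ B ≤ z 1 ∧ z 1 ≤ T)
    (hP : PathIn triGraph A a t) (ha : a 0 = L) (ht : t 1 = T)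
    (hQ : PathIn triGraph A' c d) (hc : c 0 = L) (hd : d 1 = B) (hac : a 1 < c 1) :
    ∃ z, z ∈ A ∧ z ∈ A' := by
  have haA := hA a hP.left_mem
  have hdA := hA' d hQ.right_mem
  have ray_triE0_apply : ∀ (x : Site 2) (j : ℤ), (x + j • triE0) 0 = x 0 + j ∧ (x + j • triE0) 1 = x 1 :=
    fun x j => by simp
  have ray_triE1_apply : ∀ (x : Site 2) (j : ℤ), (x + j • triE1) 0 = x 0 ∧ (x + j • triE1) 1 = x 1 + j :=
    fun x j => by simp
  -- the extended sets
  set Pcol : Set (Site 2) := {z | z 0 = L - 1 ∧ B - 1 ≤ z 1 ∧ z 1 ≤ a 1} with hPcol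
  set Qrow : Set (Site 2) := {z | z 1 = B - 1 ∧ d 0 ≤ z 0 ∧ z 0 ≤ R} with hQrow
  set Ap : Set (Site 2) := A ∪ Pcol with hAp
  set Aq : Set (Site 2) := A' ∪ {c - triE0} ∪ Qrow with hAq
  -- the extended first path: from the corner `(L-1, B-1)` up the column `L-1`, then into `a`
  set na : ℕ := (a 1 - (B - 1)).toNat with hna
  have hna' : (na : ℤ) = a 1 - (B - 1) := by rw [hna]; omega
  set p₀ : Site 2 := a - triE0 + (na : ℤ) • -triE1 with hp₀
  have hp₀0 : p₀ 0 = L - 1 := by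
    rw [hp₀, (ray_neg_triE1_apply _ _).1]; simp [ha]
  have hp₀1 : p₀ 1 = B - 1 := by
    rw [hp₀, (ray_neg_triE1_apply _ _).2]; simp [hna']
  have hPx : PathIn triGraph Ap p₀ t := by
    -- the column, traversed upwards from `p₀`
    have hcol : PathIn triGraph Ap p₀ (p₀ + (na : ℤ) • triE1) := by
      refine pathIn_line triGraph_adj_add_triE1 p₀ na fun j hj => Or.inr ?_
      refine ⟨by rw [(ray_triE1_apply _ _).1, hp₀0], ?_, ?_⟩
      · rw [(ray_triE1_apply _ _).2, hp₀1]; omega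
      · rw [(ray_triE1_apply _ _).2, hp₀1]; omega
    have htop : p₀ + (na : ℤ) • triE1 = a - triE0 := by
      rw [hp₀]; ext i; fin_cases i <;> simp [smul_neg]
    rw [htop] at hcol
    have hstep : triGraph.Adj (a - triE0) a := (triGraph_adj_sub_triE0 a).symm
    exact (hcol.tail hstep (Or.inl hP.left_mem)).trans (hP.mono subset_union_left)
  -- the extended second path: `(L-1, c₁) → c → … → d → (d₀, B-1) → … → (R, B-1)`
  set nd : ℕ := (R - d 0).toNat with hnd
  have hnd' : (nd : ℤ) = R - d 0 := by rw [hnd]; omega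
  set q₁ : Site 2 := d - triE1 + (nd : ℤ) • triE0 with hq₁
  have hq₁0 : q₁ 0 = R := by rw [hq₁, (ray_triE0_apply _ _).1]; simp [hnd']
  have hc'0 : (c - triE0) 0 = L - 1 := by simp [hc]
  have hQx : PathIn triGraph Aq (c - triE0) q₁ := by
    have h1 : PathIn triGraph Aq (c - triE0) c :=
      PathIn.of_adj (Or.inl (Or.inr rfl)) (Or.inl (Or.inl hQ.left_mem))
        (by have := triGraph_adj_sub_triE0 c; exact this.symm)
    have h2 : PathIn triGraph Aq c d := hQ.mono fun z hz => Or.inl (Or.inl hz)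
    have h3 : PathIn triGraph Aq d (d - triE1) :=
      PathIn.of_adj (Or.inl (Or.inl hQ.right_mem)) (Or.inr ⟨by simp [hd], by simp, by simp; omega⟩)
        (triGraph_adj_sub_triE1 d)
    have h4 : PathIn triGraph Aq (d - triE1) q₁ := by
      refine pathIn_line triGraph_adj_add_triE0 (d - triE1) nd fun j hj => Or.inr ?_
      refine ⟨by rw [(ray_triE0_apply _ _).2]; simp [hd], ?_, ?_⟩
      · rw [(ray_triE0_apply _ _).1]; simp
      · rw [(ray_triE0_apply _ _).1]; simp; omega
    exact ((h1.trans h2).trans h3).trans h4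
  -- bounds of the extended sets in `[L-1, R] × [B-1, T]`
  have hApb : ∀ z ∈ Ap, L - 1 ≤ z 0 ∧ z 0 ≤ R ∧ B - 1 ≤ z 1 ∧ z 1 ≤ T := by
    rintro z (hz | ⟨h0, h1, h2⟩)
    · obtain ⟨h0, h1, h2, h3⟩ := hA z hz; omega
    · omega
  have hAqb : ∀ z ∈ Aq, L - 1 ≤ z 0 ∧ z 0 ≤ R ∧ B - 1 ≤ z 1 ∧ z 1 ≤ T := by
    rintro z ((hz | hz) | ⟨h1, h2, h3⟩)
    · obtain ⟨h0, h1, h2, h3⟩ := hA' z hz; omega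
    · rw [mem_singleton_iff] at hz
      subst hz
      have hcA := hA' c hQ.left_mem
      simp; omega
    · omega
  obtain ⟨z, hzQ, hzP⟩ := PathIn.tri_crossings_meet (L := L - 1) (R := R) (B := B - 1) (T := T)
    hAqb hApb hQx hc'0 hq₁0 hPx hp₀1 ht
  -- the common site is an original one
  rcases hzP with hzA | ⟨hz0, hz1, hz2⟩
  · rcases hzQ with (hzA' | hzc) | ⟨hw1, hw2, hw3⟩
    · exact ⟨z, hzA, hzA'⟩
    · exfalso
      rw [mem_singleton_iff] at hzc
      have := (hA z hzA).1
      rw [hzc] at this; simp at this; omega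
    · exfalso; have := (hA z hzA).2.2.1; omega
  · exfalso
    rcases hzQ with (hzA' | hzc) | ⟨hw1, hw2, hw3⟩
    · have := (hA' z hzA').1; omega
    · rw [mem_singleton_iff] at hzc
      rw [hzc] at hz2; simp at hz2; omega
    · omega

/-- **Corner crossing lemma, right side**: the same at the right side of `[L, R] × [B, T]` — a
path from a site `a` of the right side to the top side meets every path from a higher site `c` of
the right side to the bottom side (extensions in `[L, R+1] × [B-1, T]`: the column
`{R+1} × [B-1, a₁]`, the site `(R+1, c₁)` and the row `{B-1} × [L, d₀]`). [cite: KestenPTM1982, §2.2 (paths crossing a rectangle must intersect)] -/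
theorem corner_meet_right {L R B T : ℤ} {A A' : Set (Site 2)} {a t c d : Site 2}
    (hA : ∀ z ∈ A, L ≤ z 0 ∧ z 0 ≤ R ∧ B ≤ z 1 ∧ z 1 ≤ T)
    (hA' : ∀ z ∈ A', L ≤ z 0 ∧ z 0 ≤ R ∧ B ≤ z 1 ∧ z 1 ≤ T)
    (hP : PathIn triGraph A a t) (ha : a 0 = R) (ht : t 1 = T)
    (hQ : PathIn triGraph A' c d) (hc : c 0 = R) (hd : d 1 = B) (hac : a 1 < c 1) :
    ∃ z, z ∈ A ∧ z ∈ A' := by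
  have haA := hA a hP.left_mem
  have hdA := hA' d hQ.right_mem
  have ray_triE0_apply : ∀ (x : Site 2) (j : ℤ), (x + j • triE0) 0 = x 0 + j ∧ (x + j • triE0) 1 = x 1 :=
    fun x j => by simp
  have ray_triE1_apply : ∀ (x : Site 2) (j : ℤ), (x + j • triE1) 0 = x 0 ∧ (x + j • triE1) 1 = x 1 + j :=
    fun x j => by simp
  set Pcol : Set (Site 2) := {z | z 0 = R + 1 ∧ B - 1 ≤ z 1 ∧ z 1 ≤ a 1} with hPcol
  set Qrow : Set (Site 2) := {z | z 1 = B - 1 ∧ L ≤ z 0 ∧ z 0 ≤ d 0} with hQrow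
  set Ap : Set (Site 2) := A ∪ Pcol with hAp
  set Aq : Set (Site 2) := A' ∪ {c + triE0} ∪ Qrow with hAq
  -- the extended first path: from the corner `(R+1, B-1)` up the column `R+1`, then into `a`
  set na : ℕ := (a 1 - (B - 1)).toNat with hna
  have hna' : (na : ℤ) = a 1 - (B - 1) := by rw [hna]; omega
  set p₀ : Site 2 := a + triE0 + (na : ℤ) • -triE1 with hp₀
  have hp₀0 : p₀ 0 = R + 1 := by
    rw [hp₀, (ray_neg_triE1_apply _ _).1]; simp [ha]
  have hp₀1 : p₀ 1 = B - 1 := by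
    rw [hp₀, (ray_neg_triE1_apply _ _).2]; simp [hna']
  have hPx : PathIn triGraph Ap p₀ t := by
    have hcol : PathIn triGraph Ap p₀ (p₀ + (na : ℤ) • triE1) := by
      refine pathIn_line triGraph_adj_add_triE1 p₀ na fun j hj => Or.inr ?_
      refine ⟨by rw [(ray_triE1_apply _ _).1, hp₀0], ?_, ?_⟩
      · rw [(ray_triE1_apply _ _).2, hp₀1]; omega
      · rw [(ray_triE1_apply _ _).2, hp₀1]; omega
    have htop : p₀ + (na : ℤ) • triE1 = a + triE0 := by
      rw [hp₀]; ext i; fin_cases i <;> simp [smul_neg]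
    rw [htop] at hcol
    have hstep : triGraph.Adj (a + triE0) a := (triGraph_adj_add_triE0 a).symm
    exact (hcol.tail hstep (Or.inl hP.left_mem)).trans (hP.mono subset_union_left)
  -- the extended second path, read from `(L, B-1)` to `(R+1, c₁)`
  set nd : ℕ := (d 0 - L).toNat with hnd
  have hnd' : (nd : ℤ) = d 0 - L := by rw [hnd]; omega
  set q₁ : Site 2 := d - triE1 + (nd : ℤ) • -triE0 with hq₁
  have hq₁0 : q₁ 0 = L := by rw [hq₁, (ray_neg_triE0_apply _ _).1]; simp [hnd']
  have hc'0 : (c + triE0) 0 = R + 1 := by simp [hc]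
  have hQx : PathIn triGraph Aq q₁ (c + triE0) := by
    have h1 : PathIn triGraph Aq (c + triE0) c :=
      PathIn.of_adj (Or.inl (Or.inr rfl)) (Or.inl (Or.inl hQ.left_mem)) (triGraph_adj_add_triE0 c).symm
    have h2 : PathIn triGraph Aq c d := hQ.mono fun z hz => Or.inl (Or.inl hz)
    have h3 : PathIn triGraph Aq d (d - triE1) :=
      PathIn.of_adj (Or.inl (Or.inl hQ.right_mem)) (Or.inr ⟨by simp [hd], by simp; omega, by simp⟩)
        (triGraph_adj_sub_triE1 d)
    have h4 : PathIn triGraph Aq (d - triE1) q₁ := by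
      refine pathIn_line triGraph_adj_add_neg_triE0 (d - triE1) nd fun j hj => Or.inr ?_
      refine ⟨by rw [(ray_neg_triE0_apply _ _).2]; simp [hd], ?_, ?_⟩
      · rw [(ray_neg_triE0_apply _ _).1]; simp; omega
      · rw [(ray_neg_triE0_apply _ _).1]; simp
    exact (((h1.trans h2).trans h3).trans h4).symm
  have hApb : ∀ z ∈ Ap, L ≤ z 0 ∧ z 0 ≤ R + 1 ∧ B - 1 ≤ z 1 ∧ z 1 ≤ T := by
    rintro z (hz | ⟨h0, h1, h2⟩)
    · obtain ⟨h0, h1, h2, h3⟩ := hA z hz; omega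
    · omega
  have hAqb : ∀ z ∈ Aq, L ≤ z 0 ∧ z 0 ≤ R + 1 ∧ B - 1 ≤ z 1 ∧ z 1 ≤ T := by
    rintro z ((hz | hz) | ⟨h1, h2, h3⟩)
    · obtain ⟨h0, h1, h2, h3⟩ := hA' z hz; omega
    · rw [mem_singleton_iff] at hz
      subst hz
      have hcA := hA' c hQ.left_mem
      simp; omega
    · omega
  obtain ⟨z, hzQ, hzP⟩ := PathIn.tri_crossings_meet (L := L) (R := R + 1) (B := B - 1) (T := T)
    hAqb hApb hQx hq₁0 hc'0 hPx hp₀1 ht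
  rcases hzP with hzA | ⟨hz0, hz1, hz2⟩
  · rcases hzQ with (hzA' | hzc) | ⟨hw1, hw2, hw3⟩
    · exact ⟨z, hzA, hzA'⟩
    · exfalso
      rw [mem_singleton_iff] at hzc
      have := (hA z hzA).2.1
      rw [hzc] at this; simp at this; omega
    · exfalso; have := (hA z hzA).2.2.1; omega
  · exfalso
    rcases hzQ with (hzA' | hzc) | ⟨hw1, hw2, hw3⟩
    · have := (hA' z hzA').2.1; omega
    · rw [mem_singleton_iff] at hzc
      rw [hzc] at hz2; simp at hz2; omega
    · omega

end Literature.Probability.Percolation
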